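import Literature.Algebra.EuclideanLattices.ARVerifierMachineBricks
import Literature.Algebra.EuclideanLattices.RegevDualQueryMachine
import Literature.Algebra.EuclideanLattices.ARVerifierVectorCert
import Literature.Computability.Cryptography.SISOddPartMachine
import HarnessLib

/-!
# The Aharonov–Regev verifier on decoded `DGS` samples as an `FP` string function (Regev 2009, Lemma 3.20)

Topic `Algebra/EuclideanLattices` (family `pqc`). Machine-level piece of the machine form of **Lemma 3.20**
of Regev 2009 (hypothesis `hL` of `Literature.Computability.Cryptography.regev_lwe_to_gapSVP_quantum_of_dgs`):
the `GapCVP′ → DGS` reduction "calls the `DGS` oracle `N` times and runs the verifier `𝒱` of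
Aharonov–Regev on the samples" (author's version arXiv:2401.03703, p. 22). In the tree the verifier is the
integer predicate `ARVerifier.MAccepts B t d v` (`ARVerifierVectorCert.lean`) on `N = nSamples n` integer
vectors `vⱼ` (the scaled dual samples): with `D = det(−B)`, `C = −adj(−B)`, `aⱼ = (B vⱼ)/D`, `gⱼ = C aⱼ`,
`eⱼ = ⟨t, gⱼ⟩`, `mⱼ = round(eⱼ/D)`, `εⱼ = eⱼ − mⱼ D`, `G = [g₁ ⋯ g_N]`, `k = 2^{powSteps n}`:

  `D ≠ 0 ∧ N D² ≤ 50 ∑ⱼ εⱼ² ∧ (100 num d)^{2k} tr((G Gᵀ)^k) ≤ (4 N (den d · D)²)^k`.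

This file writes that predicate, on the record `⟨x, ⟨c₀, …, c_{N−1}⟩⟩` (`x` the code of the `GapCVP`
instance `((B, t), d)`, `cⱼ` arbitrary strings, read as the integer vectors `decodeIntVec n cⱼ`), as ONE
total string function `verdictF ∈ FP` returning the bit `[¬ MAccepts …]` — the classical post-processor of
the reduction. Stages (all registers saturated at the width `W = |yd|` of the quartic yardstick
`yd = 1^{4096 (|z|+2)⁴}`, so that every map/loop composes in `FP`; the saturations are inactive, which is
the content of the sequel `ARVerifierMachineValue.lean`):

* readers of the instance (`FarCertMachine`: `ncW`, `BnW`, `tnW`, `numW`, `denW`, `idxnW`), the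
  Faddeev–LeVerrier machine `RegevQuery.adjF` (`D = det(−B)`, `T = (adj(−B))ᵀ`), `transposeF` (`adj(−B)`);
* `vecReadF` — the total reader `c ↦ rowCode (decodeIntVec n c)` (`SIS.OddPartFP.canonIV`, header tests,
  `tRowF` / `zeroRowF`);
* `copyItem` — per sample: `v`, `u = B v` (`gVecF`), `a = u / D` (`divRowF`), `h = adj(−B) a = −g`,
  `e' = ⟨t, h⟩ = −e` (`dotF`), `m = round(e D / D²)` (`qroundF`), `ε = e − m D`; output `⟨rowCode h, dpEnc ε⟩`;
* `recsF` (the map over the samples), `HmF` / `epsF` (the two projections), `SF = ∑ εⱼ²` (`dotF`),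
  `UF = transposeF` (the `n × N` table `G` up to sign), `MF = gramRF` (`G Gᵀ`), `MpF = sqLoopF` (`P − 1`
  squarings, `P = |bin n| = powSteps n`), `trF = traceF` (`tr((G Gᵀ)^{2^P}) = ∑ entries² of the
  `2^{P−1}`-th power`), `alphaPF`, `betaPF` (`powLoopF`), the three tests and `verdictF`.

Proved here: `verdictF ∈ FP` and the STAGEWISE VALUES on `⟨codeOf I t d, encList cs⟩` in terms of the
saturated arithmetic (`Spec.*`, Part C), ending with `verdictF_eq_spec`. No named facts.

## References

* O. Regev, *On lattices, learning with errors, random linear codes, and cryptography*, J. ACM 56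
  (2009), art. 34; author's version arXiv:2401.03703, Lemma 3.20 and its proof (p. 22). [Regev2009]
* D. Aharonov, O. Regev, *Lattice problems in NP ∩ coNP*, J. ACM 52 (2005) 749–765, §6 (the verifier `𝒱`).
  [AharonovRegev2005]
* S. Arora, B. Barak, *Computational Complexity: A Modern Approach*, CUP 2009, §1.3. [AroraBarak2009]
-/

noncomputable section

namespace Literature.Algebra.EuclideanLattices

open _root_.Computability Literature.Computability.Complexity Literature.Computability.Complexity.Brick Polynomial
open LLLMachine PRelSigPi Plumb FarCertMachine Literature.Computability.Cryptography.SIS.OddPartFP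
open scoped Matrix

namespace ARMachine

/-! ## Part A. The machine -/

/-! ### The vector reader `c ↦ rowCode (decodeIntVec n c)` -/

/-- The canonical re-encoding `⟨bin N', ⟨1ᵏ, items⟩⟩` of the raw code `c`, on `r = ⟨yd, ⟨nn, ⟨idx, c⟩⟩⟩`.
[cite: AroraBarak2009, §0.1 (representations)] -/
def vrCanon : List Bool → List Bool := canonIV ∘ sndPow 2

/-- The header test `[N' = n] ∧ [k = n]` (the two headers of `c` announce dimension `n`). [folklore] -/
def vrOk : List Bool → List Bool :=
  andFn (eqValFn ∘ fanoutFn (fstF ∘ vrCanon) (nthF 1)) (eqValFn ∘ fanoutFn (lenBinF ∘ fstF ∘ sndF ∘ vrCanon) (nthF 1))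

/-- The row of the items: `tRowF ⟨yd, ⟨nn, ⟨items, idx⟩⟩⟩`. [folklore] -/
def vrRowT : List Bool → List Bool :=
  tRowF ∘ fanoutFn (nthF 0) (fanoutFn (nthF 1) (fanoutFn (sndF ∘ sndF ∘ vrCanon) (nthF 2)))

/-- The zero row: `zeroRowF ⟨yd, ⟨nn, ⟨ε, idx⟩⟩⟩`. [folklore] -/
def vrRowZ : List Bool → List Bool :=
  AdjMachine.zeroRowF ∘ fanoutFn (nthF 0) (fanoutFn (nthF 1) (fanoutFn (fun _ => []) (nthF 2)))

/-- **The vector reader** on `⟨yd, ⟨bin n, ⟨idxList n, c⟩⟩⟩`: `rowCode (decodeIntVec n c)` — the items of `c`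
if both headers announce dimension `n`, the zero vector otherwise (`decodeIntVec_eq`), saturated at width
`|yd|`. [cite: AroraBarak2009, §0.1 (representations)] -/
def vecReadF : List Bool → List Bool := iteFn vrOk vrRowT vrRowZ

/-- `vrCanon ∈ FP`. [folklore] -/
theorem vrCanon_mem_FP : vrCanon ∈ FP := comp_mem_FP canonIV_mem_FP (sndPow_mem_FP 2)

/-- `vrOk ∈ FP`. [folklore] -/
theorem vrOk_mem_FP : vrOk ∈ FP :=
  andFn_mem_FP (comp_mem_FP eqValFn_mem_FP (fanoutFn_mem_FP (comp_mem_FP fstF_mem_FP vrCanon_mem_FP) (nthF_mem_FP 1)))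
    (comp_mem_FP eqValFn_mem_FP (fanoutFn_mem_FP (comp_mem_FP lenBinF_mem_FP (comp_mem_FP fstF_mem_FP
      (comp_mem_FP sndF_mem_FP vrCanon_mem_FP))) (nthF_mem_FP 1)))

/-- `vrOk` is a one-bit test. [folklore] -/
theorem oneBit_vrOk : OneBit vrOk := oneBit_andFn (oneBit_eqValFn.comp _) (oneBit_eqValFn.comp _)

/-- `vrRowT ∈ FP`. [folklore] -/
theorem vrRowT_mem_FP : vrRowT ∈ FP :=
  comp_mem_FP tRowF_mem_FP (fanoutFn_mem_FP (nthF_mem_FP 0) (fanoutFn_mem_FP (nthF_mem_FP 1) (fanoutFn_mem_FP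
    (comp_mem_FP sndF_mem_FP (comp_mem_FP sndF_mem_FP vrCanon_mem_FP)) (nthF_mem_FP 2))))

/-- `vrRowZ ∈ FP`. [folklore] -/
theorem vrRowZ_mem_FP : vrRowZ ∈ FP :=
  comp_mem_FP AdjMachine.zeroRowF_mem_FP (fanoutFn_mem_FP (nthF_mem_FP 0) (fanoutFn_mem_FP (nthF_mem_FP 1)
    (fanoutFn_mem_FP (const_mem_FP _) (nthF_mem_FP 2))))

/-- **`vecReadF ∈ FP`.** [cite: AroraBarak2009, §1.3] -/
theorem vecReadF_mem_FP : vecReadF ∈ FP := iteFn_mem_FP vrOk_mem_FP vrRowT_mem_FP vrRowZ_mem_FP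

/-- Length of `vecReadF`: absolute, `≤ |yd|(4|yd| + 8)` (`yd = fstF r`). [folklore] -/
theorem length_vecReadF_le (r : List Bool) : (vecReadF r).length ≤ (fstF r).length * (4 * (fstF r).length + 8) := by
  rw [vecReadF, iteFn_of_oneBit oneBit_vrOk]
  split_ifs
  · have := length_tRowF_le (fanoutFn (nthF 0) (fanoutFn (nthF 1) (fanoutFn (sndF ∘ sndF ∘ vrCanon) (nthF 2))) r)
    simpa [vrRowT] using this
  · have := AdjMachine.length_zeroRowF_le (fanoutFn (nthF 0) (fanoutFn (nthF 1) (fanoutFn (fun _ => []) (nthF 2))) r)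
    simp only [vrRowZ, Function.comp_apply, fanoutFn_apply, fstF_boolPair, nthF_zero] at this ⊢
    nlinarith

/-- The entries of the total decoder have length `k`. [folklore] -/
theorem length_entriesOf (k : ℕ) (w : List Bool) : (entriesOf k w).length = k := by
  rw [entriesOf, NegCNF.length_decList]

/-- **Semantics of `vecReadF`**: `rowCode (decodeIntVec n c)` whenever `n ≤ |yd|` and the canonical re-encoding
of `c` fits into the yardstick. [cite: AroraBarak2009, §0.1 (representations)] -/
theorem vecReadF_apply (yd : List Bool) {n : ℕ} (hn : n ≤ yd.length) (c : List Bool) (hc : (canonIV c).length ≤ yd.length) :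
    vecReadF (boolPair yd (boolPair (encodeNat n) (boolPair (idxList n) c))) = rowCode (decodeIntVec n c) := by
  have hcan : vrCanon (boolPair yd (boolPair (encodeNat n) (boolPair (idxList n) c))) =
      boolPair (encodeNat (hdrOf c)) (boolPair (unaryEncodeNat (lenOf c))
        (encList ((entriesOf (lenOf c) c).map encodingIntBool.encode))) := by
    simp only [vrCanon, Function.comp_apply, sndPow_succ_boolPair, sndPow_zero, sndF_boolPair]
    exact canonIV_apply c
  have hok : vrOk (boolPair yd (boolPair (encodeNat n) (boolPair (idxList n) c))) =
      [decide (hdrOf c = n) && decide (lenOf c = n)] := by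
    rw [vrOk, andFn_apply (b := decide (hdrOf c = n)) (b' := decide (lenOf c = n))]
    · simp only [Function.comp_apply, fanoutFn_apply, hcan, fstF_boolPair, nthF_succ_boolPair, nthF_zero_boolPair,
        eqValFn_boolPair, bitsToNat_encodeNat]
    · simp only [Function.comp_apply, fanoutFn_apply, hcan, fstF_boolPair, sndF_boolPair, nthF_succ_boolPair,
        nthF_zero_boolPair, lenBinF_apply, eqValFn_boolPair, bitsToNat_encodeNat, OracleCompose.unaryEncodeNat_eq_replicate,
        List.length_replicate]
  rw [vecReadF, iteFn_apply hok, decodeIntVec_eq]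
  by_cases h : hdrOf c = n ∧ lenOf c = n
  · obtain ⟨h1, h2⟩ := h
    have hitems : (encList ((entriesOf (lenOf c) c).map encodingIntBool.encode)).length ≤ yd.length := by
      refine le_trans ?_ hc
      rw [canonIV_apply c, length_boolPair, length_boolPair]
      omega
    rw [if_pos (by simp [h1, h2]), if_pos ⟨h1, h2⟩]
    simp only [vrRowT, Function.comp_apply, fanoutFn_apply, nthF_zero_boolPair, nthF_succ_boolPair, hcan, sndF_boolPair]
    rw [tRowF_apply yd hn]
    refine congrArg rowCode (funext fun l => ?_)
    rw [capZ_smval_elemOf hitems, h2, elemOf_encList]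
    have hl : (l : ℕ) < (entriesOf n c).length := by rw [length_entriesOf]; exact l.isLt
    rw [List.getD_eq_getElem _ _ (by simpa using hl), List.getElem_map, smval_encode, List.getD_eq_getElem _ _ hl]
  · rw [if_neg (by simpa [Bool.and_eq_true, decide_eq_true_eq] using h), if_neg h]
    simp only [vrRowZ, Function.comp_apply, fanoutFn_apply, nthF_zero_boolPair, nthF_succ_boolPair]
    rw [AdjMachine.zeroRowF_apply yd hn]

/-! ### Getters of the item record `r = ⟨yd, ⟨prm, c⟩⟩`, `prm = ⟨nn, ⟨Bm, ⟨tn, ⟨Am, ⟨dD, ⟨dD2, idx⟩⟩⟩⟩⟩⟩` -/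

/-- `yd`. [folklore] -/
def gYd : List Bool → List Bool := nthF 0
/-- `nn = bin n`. [folklore] -/
def gNn : List Bool → List Bool := fstF ∘ nthF 1
/-- `Bm = matCode B`. [folklore] -/
def gBm : List Bool → List Bool := nthF 1 ∘ nthF 1
/-- `tn = rowCode t`. [folklore] -/
def gTn : List Bool → List Bool := nthF 2 ∘ nthF 1
/-- `Am = matCode adj(−B)` (capped). [folklore] -/
def gAm : List Bool → List Bool := nthF 3 ∘ nthF 1
/-- `dD = dpEnc D`. [folklore] -/
def gDD : List Bool → List Bool := nthF 4 ∘ nthF 1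
/-- `dD2 = bin D²`. [folklore] -/
def gDD2 : List Bool → List Bool := nthF 5 ∘ nthF 1
/-- `idx = idxList n`. [folklore] -/
def gIdx : List Bool → List Bool := sndPow 5 ∘ nthF 1
/-- the raw code `c`. [folklore] -/
def gC : List Bool → List Bool := sndPow 1

/-- `gYd ∈ FP`. [folklore] -/
theorem gYd_mem_FP : gYd ∈ FP := nthF_mem_FP 0
/-- `gNn ∈ FP`. [folklore] -/
theorem gNn_mem_FP : gNn ∈ FP := comp_mem_FP fstF_mem_FP (nthF_mem_FP 1)
/-- `gBm ∈ FP`. [folklore] -/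
theorem gBm_mem_FP : gBm ∈ FP := comp_mem_FP (nthF_mem_FP 1) (nthF_mem_FP 1)
/-- `gTn ∈ FP`. [folklore] -/
theorem gTn_mem_FP : gTn ∈ FP := comp_mem_FP (nthF_mem_FP 2) (nthF_mem_FP 1)
/-- `gAm ∈ FP`. [folklore] -/
theorem gAm_mem_FP : gAm ∈ FP := comp_mem_FP (nthF_mem_FP 3) (nthF_mem_FP 1)
/-- `gDD ∈ FP`. [folklore] -/
theorem gDD_mem_FP : gDD ∈ FP := comp_mem_FP (nthF_mem_FP 4) (nthF_mem_FP 1)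
/-- `gDD2 ∈ FP`. [folklore] -/
theorem gDD2_mem_FP : gDD2 ∈ FP := comp_mem_FP (nthF_mem_FP 5) (nthF_mem_FP 1)
/-- `gIdx ∈ FP`. [folklore] -/
theorem gIdx_mem_FP : gIdx ∈ FP := comp_mem_FP (sndPow_mem_FP 5) (nthF_mem_FP 1)
/-- `gC ∈ FP`. [folklore] -/
theorem gC_mem_FP : gC ∈ FP := sndPow_mem_FP 1

/-- The parameter record of the per-sample map. [folklore] -/
def prmOf (nn Bm tn Am dD dD2 idx : List Bool) : List Bool :=
  boolPair nn (boolPair Bm (boolPair tn (boolPair Am (boolPair dD (boolPair dD2 idx)))))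

section Getters

variable (yd nn Bm tn Am dD dD2 idx c : List Bool)

/-- The getters on a well-formed item record. [folklore] -/
theorem getters_apply :
    gYd (boolPair yd (boolPair (prmOf nn Bm tn Am dD dD2 idx) c)) = yd ∧
    gNn (boolPair yd (boolPair (prmOf nn Bm tn Am dD dD2 idx) c)) = nn ∧
    gBm (boolPair yd (boolPair (prmOf nn Bm tn Am dD dD2 idx) c)) = Bm ∧
    gTn (boolPair yd (boolPair (prmOf nn Bm tn Am dD dD2 idx) c)) = tn ∧
    gAm (boolPair yd (boolPair (prmOf nn Bm tn Am dD dD2 idx) c)) = Am ∧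
    gDD (boolPair yd (boolPair (prmOf nn Bm tn Am dD dD2 idx) c)) = dD ∧
    gDD2 (boolPair yd (boolPair (prmOf nn Bm tn Am dD dD2 idx) c)) = dD2 ∧
    gIdx (boolPair yd (boolPair (prmOf nn Bm tn Am dD dD2 idx) c)) = idx ∧
    gC (boolPair yd (boolPair (prmOf nn Bm tn Am dD dD2 idx) c)) = c := by
  simp [gYd, gNn, gBm, gTn, gAm, gDD, gDD2, gIdx, gC, prmOf]

end Getters

/-! ### The per-sample computation -/

/-- `v = rowCode (decodeIntVec n c)`. [cite: Regev2009, Lemma 3.20 (proof: the DGS samples)] -/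
def cVF : List Bool → List Bool := vecReadF ∘ fanoutFn gYd (fanoutFn gNn (fanoutFn gIdx gC))
/-- `u = B v` (capped). [folklore] -/
def cUF : List Bool → List Bool := gVecF ∘ fanoutFn gYd (fanoutFn gNn (fanoutFn (fanoutFn gNn cVF) gBm))
/-- `a = u / D` entrywise (capped): the coordinates `aⱼ = (B vⱼ)/D` of the certificate.
[cite: AharonovRegev2005, §6 (the witness matrix, coordinates in the basis) — variant] -/
def cAF : List Bool → List Bool := divRowF ∘ fanoutFn gYd (fanoutFn gNn (fanoutFn (fanoutFn cUF gDD) gIdx))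
/-- `h = adj(−B) a = −gⱼ` (capped). [folklore] -/
def cHF : List Bool → List Bool := gVecF ∘ fanoutFn gYd (fanoutFn gNn (fanoutFn (fanoutFn gNn cAF) gAm))
/-- `e' = ⟨t, h⟩ = −eⱼ`. [folklore] -/
def cEF : List Bool → List Bool := dotF ∘ fanoutFn gYd (fanoutFn gNn (fanoutFn gTn cHF))
/-- `m = round((−e') D / D²) = round(eⱼ/D)`. [cite: AharonovRegev2005, §6 (nearest integers to the phases) — variant] -/
def cMF : List Bool → List Bool := qroundF ∘ fanoutFn (zmulF ∘ fanoutFn (znegF ∘ cEF) gDD) gDD2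
/-- `ε = −e' − m D = eⱼ − mⱼ D` (capped). [folklore] -/
def cRF : List Bool → List Bool := zcapF ∘ fanoutFn gYd (zsubF ∘ fanoutFn (znegF ∘ cEF) (zmulF ∘ fanoutFn cMF gDD))
/-- **The per-sample record** `⟨rowCode h, dpEnc ε⟩`. [cite: Regev2009, Lemma 3.20 (proof)] -/
def copyItem : List Bool → List Bool := fanoutFn cHF cRF

/-- `cVF ∈ FP`. [folklore] -/
theorem cVF_mem_FP : cVF ∈ FP :=
  comp_mem_FP vecReadF_mem_FP (fanoutFn_mem_FP gYd_mem_FP (fanoutFn_mem_FP gNn_mem_FP (fanoutFn_mem_FP gIdx_mem_FP gC_mem_FP)))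
/-- `cUF ∈ FP`. [folklore] -/
theorem cUF_mem_FP : cUF ∈ FP :=
  comp_mem_FP gVecF_mem_FP (fanoutFn_mem_FP gYd_mem_FP (fanoutFn_mem_FP gNn_mem_FP (fanoutFn_mem_FP (fanoutFn_mem_FP gNn_mem_FP cVF_mem_FP) gBm_mem_FP)))
/-- `cAF ∈ FP`. [folklore] -/
theorem cAF_mem_FP : cAF ∈ FP :=
  comp_mem_FP divRowF_mem_FP (fanoutFn_mem_FP gYd_mem_FP (fanoutFn_mem_FP gNn_mem_FP (fanoutFn_mem_FP (fanoutFn_mem_FP cUF_mem_FP gDD_mem_FP) gIdx_mem_FP)))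
/-- `cHF ∈ FP`. [folklore] -/
theorem cHF_mem_FP : cHF ∈ FP :=
  comp_mem_FP gVecF_mem_FP (fanoutFn_mem_FP gYd_mem_FP (fanoutFn_mem_FP gNn_mem_FP (fanoutFn_mem_FP (fanoutFn_mem_FP gNn_mem_FP cAF_mem_FP) gAm_mem_FP)))
/-- `cEF ∈ FP`. [folklore] -/
theorem cEF_mem_FP : cEF ∈ FP :=
  comp_mem_FP dotF_mem_FP (fanoutFn_mem_FP gYd_mem_FP (fanoutFn_mem_FP gNn_mem_FP (fanoutFn_mem_FP gTn_mem_FP cHF_mem_FP)))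
/-- `cMF ∈ FP`. [folklore] -/
theorem cMF_mem_FP : cMF ∈ FP :=
  comp_mem_FP qroundF_mem_FP (fanoutFn_mem_FP (comp_mem_FP zmulF_mem_FP (fanoutFn_mem_FP (comp_mem_FP znegF_mem_FP cEF_mem_FP) gDD_mem_FP)) gDD2_mem_FP)
/-- `cRF ∈ FP`. [folklore] -/
theorem cRF_mem_FP : cRF ∈ FP :=
  comp_mem_FP zcapF_mem_FP (fanoutFn_mem_FP gYd_mem_FP (comp_mem_FP zsubF_mem_FP (fanoutFn_mem_FP (comp_mem_FP znegF_mem_FP cEF_mem_FP)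
    (comp_mem_FP zmulF_mem_FP (fanoutFn_mem_FP cMF_mem_FP gDD_mem_FP)))))
/-- **`copyItem ∈ FP`.** [cite: AroraBarak2009, §1.3] -/
theorem copyItem_mem_FP : copyItem ∈ FP := fanoutFn_mem_FP cHF_mem_FP cRF_mem_FP

/-- Length of `gVecF`: absolute, `≤ |Y|(4|Y| + 8)`. [folklore] -/
theorem length_gVecF_le (z : List Bool) : (gVecF z).length ≤ (fstF z).length * (4 * (fstF z).length + 8) := by
  have h := length_mapLF_le (f := gItem) 0 (P := 2 * X + 2) length_gItem_le z
  simp only [zero_mul, zero_add, eval_add, eval_mul, eval_ofNat, eval_X] at h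
  rw [gVecF]
  nlinarith

/-- Length of `cHF`: absolute in the yardstick. [folklore] -/
theorem length_cHF_le (r : List Bool) : (cHF r).length ≤ (gYd r).length * (4 * (gYd r).length + 8) := by
  have e : fstF (fanoutFn gYd (fanoutFn gNn (fanoutFn (fanoutFn gNn cAF) gAm)) r) = gYd r := by
    rw [fanoutFn_apply, fstF_boolPair]
  calc (cHF r).length = (gVecF (fanoutFn gYd (fanoutFn gNn (fanoutFn (fanoutFn gNn cAF) gAm)) r)).length := rfl
    _ ≤ _ := length_gVecF_le _
    _ = (gYd r).length * (4 * (gYd r).length + 8) := by rw [e]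

/-- Length of `cRF`: `≤ 2|yd| + 2`. [folklore] -/
theorem length_cRF_le (r : List Bool) : (cRF r).length ≤ 2 * (gYd r).length + 2 := by
  have e : fstF (fanoutFn gYd (zsubF ∘ fanoutFn (znegF ∘ cEF) (zmulF ∘ fanoutFn cMF gDD)) r) = gYd r := by
    rw [fanoutFn_apply, fstF_boolPair]
  calc (cRF r).length = (zcapF (fanoutFn gYd (zsubF ∘ fanoutFn (znegF ∘ cEF) (zmulF ∘ fanoutFn cMF gDD)) r)).length := rfl
    _ ≤ _ := length_zcapF_le _
    _ = 2 * (gYd r).length + 2 := by rw [e]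

/-- **`copyItem` has absolutely bounded output**: `≤ |yd|(8|yd| + 18) + 4`. [folklore] -/
theorem length_copyItem_le (yd p c : List Bool) :
    (copyItem (boolPair yd (boolPair p c))).length ≤ 0 * c.length + (X * (8 * X + 18) + 4 : Polynomial ℕ).eval yd.length := by
  have hH := length_cHF_le (boolPair yd (boolPair p c))
  have hR := length_cRF_le (boolPair yd (boolPair p c))
  have e : gYd (boolPair yd (boolPair p c)) = yd := by simp [gYd]
  rw [e] at hH hR
  rw [copyItem, fanoutFn_apply, length_boolPair]
  simp only [eval_add, eval_mul, eval_ofNat, eval_X, zero_mul, zero_add]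
  nlinarith

/-! ### From the input `z = ⟨x, ⟨c₀, …⟩⟩` to the verdict -/

/-- The quartic yardstick polynomial `4096 (X + 2)⁴`. [folklore] -/
def ydPoly : Polynomial ℕ := C 4096 * (X + C 2) ^ 4
/-- The yardstick `yd = 1^{4096 (|z|+2)⁴}`. [folklore] -/
def ydF : List Bool → List Bool := polyFn ydPoly
/-- `⟨dpEnc det(−B), matCode (adj(−B))ᵀ⟩` (`RegevQuery.adjF`). [folklore] -/
def dDF : List Bool → List Bool := fstF ∘ RegevQuery.adjF
/-- `T = matCode (adj(−B))ᵀ`. [folklore] -/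
def TF : List Bool → List Bool := sndF ∘ RegevQuery.adjF
/-- `Am = matCode adj(−B)` (the capped transpose of `T`). [folklore] -/
def AmF : List Bool → List Bool :=
  transposeF ∘ fanoutFn ydF (fanoutFn ncW (fanoutFn (fanoutFn ncW (fanoutFn TF idxnW)) idxnW))
/-- `bin D²` (`= bin |D|·|D|`). [folklore] -/
def dD2F : List Bool → List Bool := prodFn ∘ fanoutFn (zmagF ∘ dDF) (zmagF ∘ dDF)
/-- `bin (n + 1)`. [folklore] -/
def n1F : List Bool → List Bool := addFn ∘ fanoutFn ncW (fun _ => [true])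
/-- `bin (n + 1)²`. [folklore] -/
def n2F : List Bool → List Bool := prodFn ∘ fanoutFn n1F n1F
/-- `bin (n + 1)⁴`. [folklore] -/
def n4F : List Bool → List Bool := prodFn ∘ fanoutFn n2F n2F
/-- `bin N`, `N = nSamples n = 3000 (n + 1)⁴`. [cite: AharonovRegev2005, §6 (p. 10) — variant (the sample count)] -/
def nNF : List Bool → List Bool := prodFn ∘ fanoutFn (fun _ => encodeNat 3000) n4F
/-- `idxList N`. [folklore] -/
def idxNF : List Bool → List Bool := iotaF ∘ fanoutFn ydF nNF
/-- `bin P`, `P = |bin n|` (`= powSteps n` for `n ≥ 1`). [cite: AharonovRegev2005, §6 (p. 10) — variant (the power in test (c))] -/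
def pPF : List Bool → List Bool := lenBinF ∘ ncW
/-- `bin (P − 1)`. [folklore] -/
def pPm1F : List Bool → List Bool := subFn ∘ fanoutFn pPF (fun _ => [true])
/-- The parameter record of the per-sample map. [folklore] -/
def prmF : List Bool → List Bool :=
  fanoutFn ncW (fanoutFn BnW (fanoutFn tnW (fanoutFn AmF (fanoutFn dDF (fanoutFn dD2F idxnW)))))
/-- **The per-sample records** `⟨hⱼ, εⱼ⟩`, `j < N`. [cite: Regev2009, Lemma 3.20 (proof)] -/
def recsF : List Bool → List Bool := mapLF copyItem ∘ fanoutFn ydF (fanoutFn nNF (fanoutFn prmF sndF))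
/-- The projection item `rec ↦ fstF rec`. [folklore] -/
def hItem : List Bool → List Bool := fstF ∘ sndPow 1
/-- The projection item `rec ↦ sndF rec`. [folklore] -/
def eItem : List Bool → List Bool := sndF ∘ sndPow 1
/-- `Hm = matCode (j ↦ hⱼ)` (`N × n`). [folklore] -/
def HmF : List Bool → List Bool := mapLF hItem ∘ fanoutFn ydF (fanoutFn nNF (fanoutFn (fun _ => []) recsF))
/-- `rowCode (j ↦ εⱼ)`. [folklore] -/
def epsF : List Bool → List Bool := mapLF eItem ∘ fanoutFn ydF (fanoutFn nNF (fanoutFn (fun _ => []) recsF))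
/-- `S = ∑ⱼ εⱼ²` (test (a'')). [cite: AharonovRegev2005, §6 test (a) — variant] -/
def SF : List Bool → List Bool := dotF ∘ fanoutFn ydF (fanoutFn nNF (fanoutFn epsF epsF))
/-- `U = matCode (i j ↦ hⱼ i)` (`n × N`, the sample matrix up to sign). [cite: AharonovRegev2005, §6 (the witness matrix W)] -/
def UF : List Bool → List Bool :=
  transposeF ∘ fanoutFn ydF (fanoutFn ncW (fanoutFn (fanoutFn nNF (fanoutFn HmF idxNF)) idxnW))
/-- `M = G Gᵀ` (capped Gram matrix of the rows of `U`). [cite: AharonovRegev2005, §6 test (c) (the matrix W Wᵀ)] -/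
def MF : List Bool → List Bool := gramRF ∘ fanoutFn ydF (fanoutFn ncW (fanoutFn nNF UF))
/-- `M' = M^{2^{P−1}}` by `P − 1` squarings. [cite: AharonovRegev2005, §6 test (c) — variant (trace of a power)] -/
def MpF : List Bool → List Bool := sndPow 3 ∘ sqLoopF ∘ fanoutFn ydF (fanoutFn pPm1F (fanoutFn ncW (fanoutFn idxnW MF)))
/-- `tr = ∑ᵢ ∑ₜ M'ᵢₜ² = tr((G Gᵀ)^{2^P})`. [cite: AharonovRegev2005, §6 test (c) — variant (trace of a power)] -/
def trF : List Bool → List Bool := AdjMachine.traceF ∘ fanoutFn ydF (fanoutFn ncW (fanoutFn MpF MpF))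
/-- `bin (100 |num d|)`. [folklore] -/
def a1F : List Bool → List Bool := prodFn ∘ fanoutFn (fun _ => encodeNat 100) numW
/-- `dpEnc ((100 |num d|)²)`. [folklore] -/
def alphaF : List Bool → List Bool := natZF ∘ prodFn ∘ fanoutFn a1F a1F
/-- `dpEnc ((100 |num d|)^{2·2^P})` (capped). [folklore] -/
def alphaPF : List Bool → List Bool := sndPow 1 ∘ powLoopF ∘ fanoutFn ydF (fanoutFn pPF alphaF)
/-- `dpEnc (den d · D)`. [folklore] -/
def denDF : List Bool → List Bool := zmulF ∘ fanoutFn (natZF ∘ denW) dDF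
/-- `dpEnc (4 N (den d · D)²)`. [folklore] -/
def betaF : List Bool → List Bool :=
  zmulF ∘ fanoutFn (natZF ∘ prodFn ∘ fanoutFn (fun _ => encodeNat 4) nNF) (zmulF ∘ fanoutFn denDF denDF)
/-- `dpEnc ((4 N (den d · D)²)^{2^P})` (capped). [folklore] -/
def betaPF : List Bool → List Bool := sndPow 1 ∘ powLoopF ∘ fanoutFn ydF (fanoutFn pPF betaF)
/-- Test 1: `[D ≠ 0]`. [cite: AharonovRegev2005, §6 (check 1) — variant] -/
def test1F : List Bool → List Bool := notFn (isZeroFn ∘ dDF)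
/-- Test (a''): `[N D² ≤ 50 S]`. [cite: AharonovRegev2005, §6 test (a) — variant] -/
def test2F : List Bool → List Bool :=
  zleF ∘ fanoutFn (zmulF ∘ fanoutFn (natZF ∘ nNF) (zmulF ∘ fanoutFn dDF dDF)) (zmulF ∘ fanoutFn (fun _ => dpEnc 50) SF)
/-- Test (c'): `[(100 num d)^{2·2^P} tr ≤ (4 N (den d · D)²)^{2^P}]`. [cite: AharonovRegev2005, §6 test (c) — variant] -/
def test3F : List Bool → List Bool := zleF ∘ fanoutFn (zmulF ∘ fanoutFn alphaPF trF) betaPF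
/-- **The verdict** `[¬ (test 1 ∧ test (a'') ∧ test (c'))]` of the reduction of Regev's Lemma 3.20: YES iff the
Aharonov–Regev verifier REJECTS the decoded samples. [cite: Regev2009, Lemma 3.20 (proof, p. 22)] -/
def verdictF : List Bool → List Bool := notFn (andFn test1F (andFn test2F test3F))

/-! ### Polynomial time -/

/-- `ydF ∈ FP`. [folklore] -/
theorem ydF_mem_FP : ydF ∈ FP := polyFn_mem_FP _
/-- `dDF ∈ FP`. [folklore] -/
theorem dDF_mem_FP : dDF ∈ FP := comp_mem_FP fstF_mem_FP RegevQuery.adjF_mem_FP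
/-- `TF ∈ FP`. [folklore] -/
theorem TF_mem_FP : TF ∈ FP := comp_mem_FP sndF_mem_FP RegevQuery.adjF_mem_FP
/-- `AmF ∈ FP`. [folklore] -/
theorem AmF_mem_FP : AmF ∈ FP :=
  comp_mem_FP transposeF_mem_FP (fanoutFn_mem_FP ydF_mem_FP (fanoutFn_mem_FP ncW_mem_FP (fanoutFn_mem_FP
    (fanoutFn_mem_FP ncW_mem_FP (fanoutFn_mem_FP TF_mem_FP idxnW_mem_FP)) idxnW_mem_FP)))
/-- `dD2F ∈ FP`. [folklore] -/
theorem dD2F_mem_FP : dD2F ∈ FP :=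
  comp_mem_FP prodFn_mem_FP (fanoutFn_mem_FP (comp_mem_FP zmagF_mem_FP dDF_mem_FP) (comp_mem_FP zmagF_mem_FP dDF_mem_FP))
/-- `n1F ∈ FP`. [folklore] -/
theorem n1F_mem_FP : n1F ∈ FP := comp_mem_FP addFn_mem_FP (fanoutFn_mem_FP ncW_mem_FP (const_mem_FP _))
/-- `n2F ∈ FP`. [folklore] -/
theorem n2F_mem_FP : n2F ∈ FP := comp_mem_FP prodFn_mem_FP (fanoutFn_mem_FP n1F_mem_FP n1F_mem_FP)
/-- `n4F ∈ FP`. [folklore] -/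
theorem n4F_mem_FP : n4F ∈ FP := comp_mem_FP prodFn_mem_FP (fanoutFn_mem_FP n2F_mem_FP n2F_mem_FP)
/-- `nNF ∈ FP`. [folklore] -/
theorem nNF_mem_FP : nNF ∈ FP := comp_mem_FP prodFn_mem_FP (fanoutFn_mem_FP (const_mem_FP _) n4F_mem_FP)
/-- `idxNF ∈ FP`. [folklore] -/
theorem idxNF_mem_FP : idxNF ∈ FP := comp_mem_FP iotaF_mem_FP (fanoutFn_mem_FP ydF_mem_FP nNF_mem_FP)
/-- `pPF ∈ FP`. [folklore] -/
theorem pPF_mem_FP : pPF ∈ FP := comp_mem_FP lenBinF_mem_FP ncW_mem_FP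
/-- `pPm1F ∈ FP`. [folklore] -/
theorem pPm1F_mem_FP : pPm1F ∈ FP := comp_mem_FP subFn_mem_FP (fanoutFn_mem_FP pPF_mem_FP (const_mem_FP _))
/-- `prmF ∈ FP`. [folklore] -/
theorem prmF_mem_FP : prmF ∈ FP :=
  fanoutFn_mem_FP ncW_mem_FP (fanoutFn_mem_FP BnW_mem_FP (fanoutFn_mem_FP tnW_mem_FP (fanoutFn_mem_FP AmF_mem_FP
    (fanoutFn_mem_FP dDF_mem_FP (fanoutFn_mem_FP dD2F_mem_FP idxnW_mem_FP)))))
/-- `recsF ∈ FP`. [cite: AroraBarak2009, §1.3] -/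
theorem recsF_mem_FP : recsF ∈ FP :=
  comp_mem_FP (mapLF_mem_FP copyItem_mem_FP (w := 0) (by norm_num) length_copyItem_le)
    (fanoutFn_mem_FP ydF_mem_FP (fanoutFn_mem_FP nNF_mem_FP (fanoutFn_mem_FP prmF_mem_FP sndF_mem_FP)))
/-- `hItem ∈ FP`. [folklore] -/
theorem hItem_mem_FP : hItem ∈ FP := comp_mem_FP fstF_mem_FP (sndPow_mem_FP 1)
/-- `eItem ∈ FP`. [folklore] -/
theorem eItem_mem_FP : eItem ∈ FP := comp_mem_FP sndF_mem_FP (sndPow_mem_FP 1)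
/-- The projections are bounded by the item. [folklore] -/
theorem length_hItem_le (x p a : List Bool) : (hItem (boolPair x (boolPair p a))).length ≤ 1 * a.length + (0 : Polynomial ℕ).eval x.length := by
  have := length_fstF_sndF_le a
  simp only [hItem, Function.comp_apply, sndPow_succ_boolPair, sndPow_zero, sndF_boolPair, eval_zero, one_mul, add_zero]
  omega
/-- The projections are bounded by the item. [folklore] -/
theorem length_eItem_le (x p a : List Bool) : (eItem (boolPair x (boolPair p a))).length ≤ 1 * a.length + (0 : Polynomial ℕ).eval x.length := by
  have := length_fstF_sndF_le a
  simp only [eItem, Function.comp_apply, sndPow_succ_boolPair, sndPow_zero, sndF_boolPair, eval_zero, one_mul, add_zero]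
  omega
/-- `HmF ∈ FP`. [folklore] -/
theorem HmF_mem_FP : HmF ∈ FP :=
  comp_mem_FP (mapLF_mem_FP hItem_mem_FP (w := 1) (by norm_num) length_hItem_le)
    (fanoutFn_mem_FP ydF_mem_FP (fanoutFn_mem_FP nNF_mem_FP (fanoutFn_mem_FP (const_mem_FP _) recsF_mem_FP)))
/-- `epsF ∈ FP`. [folklore] -/
theorem epsF_mem_FP : epsF ∈ FP :=
  comp_mem_FP (mapLF_mem_FP eItem_mem_FP (w := 1) (by norm_num) length_eItem_le)
    (fanoutFn_mem_FP ydF_mem_FP (fanoutFn_mem_FP nNF_mem_FP (fanoutFn_mem_FP (const_mem_FP _) recsF_mem_FP)))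
/-- `SF ∈ FP`. [folklore] -/
theorem SF_mem_FP : SF ∈ FP :=
  comp_mem_FP dotF_mem_FP (fanoutFn_mem_FP ydF_mem_FP (fanoutFn_mem_FP nNF_mem_FP (fanoutFn_mem_FP epsF_mem_FP epsF_mem_FP)))
/-- `UF ∈ FP`. [folklore] -/
theorem UF_mem_FP : UF ∈ FP :=
  comp_mem_FP transposeF_mem_FP (fanoutFn_mem_FP ydF_mem_FP (fanoutFn_mem_FP ncW_mem_FP (fanoutFn_mem_FP
    (fanoutFn_mem_FP nNF_mem_FP (fanoutFn_mem_FP HmF_mem_FP idxNF_mem_FP)) idxnW_mem_FP)))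
/-- `MF ∈ FP`. [folklore] -/
theorem MF_mem_FP : MF ∈ FP :=
  comp_mem_FP gramRF_mem_FP (fanoutFn_mem_FP ydF_mem_FP (fanoutFn_mem_FP ncW_mem_FP (fanoutFn_mem_FP nNF_mem_FP UF_mem_FP)))
/-- `MpF ∈ FP`. [folklore] -/
theorem MpF_mem_FP : MpF ∈ FP :=
  comp_mem_FP (sndPow_mem_FP 3) (comp_mem_FP sqLoopF_mem_FP (fanoutFn_mem_FP ydF_mem_FP (fanoutFn_mem_FP pPm1F_mem_FP
    (fanoutFn_mem_FP ncW_mem_FP (fanoutFn_mem_FP idxnW_mem_FP MF_mem_FP)))))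
/-- `trF ∈ FP`. [folklore] -/
theorem trF_mem_FP : trF ∈ FP :=
  comp_mem_FP AdjMachine.traceF_mem_FP (fanoutFn_mem_FP ydF_mem_FP (fanoutFn_mem_FP ncW_mem_FP (fanoutFn_mem_FP MpF_mem_FP MpF_mem_FP)))
/-- `a1F ∈ FP`. [folklore] -/
theorem a1F_mem_FP : a1F ∈ FP := comp_mem_FP prodFn_mem_FP (fanoutFn_mem_FP (const_mem_FP _) numW_mem_FP)
/-- `alphaF ∈ FP`. [folklore] -/
theorem alphaF_mem_FP : alphaF ∈ FP := comp_mem_FP natZF_mem_FP (comp_mem_FP prodFn_mem_FP (fanoutFn_mem_FP a1F_mem_FP a1F_mem_FP))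
/-- `alphaPF ∈ FP`. [folklore] -/
theorem alphaPF_mem_FP : alphaPF ∈ FP :=
  comp_mem_FP (sndPow_mem_FP 1) (comp_mem_FP powLoopF_mem_FP (fanoutFn_mem_FP ydF_mem_FP (fanoutFn_mem_FP pPF_mem_FP alphaF_mem_FP)))
/-- `denDF ∈ FP`. [folklore] -/
theorem denDF_mem_FP : denDF ∈ FP := comp_mem_FP zmulF_mem_FP (fanoutFn_mem_FP (comp_mem_FP natZF_mem_FP denW_mem_FP) dDF_mem_FP)
/-- `betaF ∈ FP`. [folklore] -/
theorem betaF_mem_FP : betaF ∈ FP :=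
  comp_mem_FP zmulF_mem_FP (fanoutFn_mem_FP (comp_mem_FP natZF_mem_FP (comp_mem_FP prodFn_mem_FP (fanoutFn_mem_FP (const_mem_FP _) nNF_mem_FP)))
    (comp_mem_FP zmulF_mem_FP (fanoutFn_mem_FP denDF_mem_FP denDF_mem_FP)))
/-- `betaPF ∈ FP`. [folklore] -/
theorem betaPF_mem_FP : betaPF ∈ FP :=
  comp_mem_FP (sndPow_mem_FP 1) (comp_mem_FP powLoopF_mem_FP (fanoutFn_mem_FP ydF_mem_FP (fanoutFn_mem_FP pPF_mem_FP betaF_mem_FP)))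
/-- `test1F ∈ FP`. [folklore] -/
theorem test1F_mem_FP : test1F ∈ FP := notFn_mem_FP (comp_mem_FP isZeroFn_mem_FP dDF_mem_FP)
/-- `test2F ∈ FP`. [folklore] -/
theorem test2F_mem_FP : test2F ∈ FP :=
  comp_mem_FP zleF_mem_FP (fanoutFn_mem_FP (comp_mem_FP zmulF_mem_FP (fanoutFn_mem_FP (comp_mem_FP natZF_mem_FP nNF_mem_FP)
    (comp_mem_FP zmulF_mem_FP (fanoutFn_mem_FP dDF_mem_FP dDF_mem_FP)))) (comp_mem_FP zmulF_mem_FP (fanoutFn_mem_FP (const_mem_FP _) SF_mem_FP)))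
/-- `test3F ∈ FP`. [folklore] -/
theorem test3F_mem_FP : test3F ∈ FP :=
  comp_mem_FP zleF_mem_FP (fanoutFn_mem_FP (comp_mem_FP zmulF_mem_FP (fanoutFn_mem_FP alphaPF_mem_FP trF_mem_FP)) betaPF_mem_FP)
/-- **`verdictF ∈ FP`**: the post-processor of Regev's Lemma 3.20 reduction runs in polynomial time.
[cite: Regev2009, Lemma 3.20 ("a polynomial time reduction")] [cite: AroraBarak2009, §1.3] -/
theorem verdictF_mem_FP : verdictF ∈ FP := notFn_mem_FP (andFn_mem_FP test1F_mem_FP (andFn_mem_FP test2F_mem_FP test3F_mem_FP))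

/-! ## Part B. The saturated arithmetic computed by the machine -/

namespace Spec

variable {n : ℕ} (W : ℕ) (B : Matrix (Fin n) (Fin n) ℤ) (t : Fin n → ℤ) (d : ℚ)

/-- `D = det(−B)`. [folklore] -/
def D : ℤ := (-B).det

/-- The capped `adj(−B)` as read back from the transposed table. [folklore] -/
def Ad : Matrix (Fin n) (Fin n) ℤ := fun l j => capZ W ((-B).adjugate l j)

variable (v : Fin n → ℤ)

/-- `u = B v`, capped. [folklore] -/
def u : Fin n → ℤ := fun i => capZ W (∑ l, B i l * v l)
/-- `a = u / D`, capped. [folklore] -/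
def a : Fin n → ℤ := fun i => capZ W (u W B v i / D B)
/-- `h = adj(−B) a`, capped. [folklore] -/
def h : Fin n → ℤ := fun i => capZ W (∑ l, Ad W B i l * a W B v l)
/-- `e' = ⟨t, h⟩`. [folklore] -/
def e : ℤ := ∑ l, t l * h W B v l
/-- `m = round((−e') D / |D|²)`. [folklore] -/
def m : ℤ := round ((((-e W B t v) * D B : ℤ) : ℚ) / (((D B).natAbs * (D B).natAbs : ℕ) : ℚ))
/-- `ε = −e' − m D`, capped. [folklore] -/
def r : ℤ := capZ W (-e W B t v - m W B t v * D B)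

variable {N : ℕ} (vs : Fin N → Fin n → ℤ)

/-- `S = ∑ⱼ εⱼ²`. [folklore] -/
def S : ℤ := ∑ j, r W B t (vs j) * r W B t (vs j)
/-- `U i j = capZ (hⱼ i)`. [folklore] -/
def U : Fin n → Fin N → ℤ := fun i j => capZ W (h W B (vs j) i)
/-- `M = capped (U Uᵀ)`. [folklore] -/
def M : Matrix (Fin n) (Fin n) ℤ := fun i k => capZ W (∑ j, U W B vs i j * U W B vs k j)
/-- `M' = (sqStep W)^[P − 1] M`, `P = |bin n|`. [folklore] -/
def Mp : Matrix (Fin n) (Fin n) ℤ := (sqStep W)^[(encodeNat n).length - 1] (M W B vs)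
/-- `tr = capZ (∑ᵢ ∑ₜ M'ᵢₜ²)`. [folklore] -/
def tr : ℤ := capZ W (∑ i, ∑ l, Mp W B vs i l * Mp W B vs i l)
/-- `αP = (sqZ W)^[P] ((100 |num d|)²)`. [folklore] -/
def alphaP : ℤ := (sqZ W)^[(encodeNat n).length] ((100 * d.num.natAbs * (100 * d.num.natAbs) : ℕ) : ℤ)
/-- `βP = (sqZ W)^[P] (4 N (den d · D)²)`. [folklore] -/
def betaP : ℤ := (sqZ W)^[(encodeNat n).length] (((4 * N : ℕ) : ℤ) * ((d.den : ℤ) * D B * ((d.den : ℤ) * D B)))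
/-- The verdict as a Boolean. [folklore] -/
def verdict : Bool :=
  !(decide (D B ≠ 0) && (decide (((N : ℕ) : ℤ) * (D B * D B) ≤ 50 * S W B t vs) && decide (alphaP (n := n) W d * tr W B vs ≤ betaP (N := N) W B d)))

end Spec

/-! ## Part C. The values of the stages on `⟨codeOf I t d, encList cs⟩` -/

section Value

variable (I : LatticeInstance) (t : Fin I.n → ℤ) (d : ℚ) (cs : List (List Bool))

/-- The input record. [folklore] -/
abbrev inp : List Bool := boolPair (codeOf I t d) (encList cs)

/-- The decoded vectors `vⱼ = decodeIntVec n cⱼ`, `j < N`. [cite: Regev2009, Lemma 3.20 (proof: the samples)] -/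
def vOf (N : ℕ) : Fin N → Fin I.n → ℤ := fun j => decodeIntVec I.n (cs.getD j [])

/-- The width `W = |yd|` of the registers on the input. [folklore] -/
def Wd : ℕ := (ydF (inp I t d cs)).length

/-- Length of the yardstick (the definition of `Wd`). [folklore] -/
theorem length_ydF_inp : (ydF (inp I t d cs)).length = Wd I t d cs := rfl

/-- `W = 4096 (|z| + 2)⁴`. [folklore] -/
theorem Wd_eq : Wd I t d cs = 4096 * ((inp I t d cs).length + 2) ^ 4 := by
  rw [Wd, ydF, polyFn_apply, ydPoly, ones, List.length_replicate]
  simp [eval_mul, eval_pow, eval_add, eval_X]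

/-- `|z| + 2 ≤ W`. [folklore] -/
theorem length_inp_le_Wd : (inp I t d cs).length + 2 ≤ Wd I t d cs := by
  have h1 : (inp I t d cs).length + 2 ≤ ((inp I t d cs).length + 2) ^ 4 := by
    calc (inp I t d cs).length + 2 = ((inp I t d cs).length + 2) ^ 1 := (pow_one _).symm
      _ ≤ ((inp I t d cs).length + 2) ^ 4 := Nat.pow_le_pow_right (by omega) (by norm_num)
  rw [Wd_eq]; nlinarith

/-- `|x| ≤ W`. [folklore] -/
theorem length_codeOf_le_Wd : (codeOf I t d).length ≤ Wd I t d cs := by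
  have := length_inp_le_Wd I t d cs
  rw [inp, length_boolPair] at this
  omega

/-- `n ≤ W`. [folklore] -/
theorem n_le_Wd : I.n ≤ Wd I t d cs := (RegevQuery.n_le_length_codeOf I t d).trans (length_codeOf_le_Wd I t d cs)

/-- `nSamples n ≤ W`. [folklore] -/
theorem nSamples_le_Wd : ARVerifier.nSamples I.n ≤ Wd I t d cs := by
  have h1 : I.n + 1 ≤ (inp I t d cs).length + 2 := by
    have := RegevQuery.n_le_length_codeOf I t d
    rw [inp, length_boolPair]; omega
  have := Nat.pow_le_pow_left h1 4
  rw [ARVerifier.nSamples, Wd_eq]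
  calc 3000 * (I.n + 1) ^ 4 ≤ 3000 * ((inp I t d cs).length + 2) ^ 4 := Nat.mul_le_mul_left _ this
    _ ≤ 4096 * ((inp I t d cs).length + 2) ^ 4 := Nat.mul_le_mul_right _ (by norm_num)

/-- `|bin n| ≤ W`. [folklore] -/
theorem length_encodeNat_n_le_Wd : (encodeNat I.n).length ≤ Wd I t d cs := by
  rw [TM2Pass.length_encodeNat_eq_size]
  exact (Nat.size_le.2 Nat.lt_two_pow_self).trans (n_le_Wd I t d cs)

/-- `dDF` on the input: `dpEnc det(−B)`. [folklore] -/
theorem dDF_inp : dDF (inp I t d cs) = dpEnc (Spec.D I.basis) := by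
  rw [dDF, Function.comp_apply, inp, RegevQuery.adjF_input, fstF_boolPair, Spec.D]

/-- `TF` on the input: `matCode (adj(−B))ᵀ`. [folklore] -/
theorem TF_inp : TF (inp I t d cs) = matCode (fun k i : Fin I.n => (-I.basis).adjugate i k) := by
  rw [TF, Function.comp_apply, inp, RegevQuery.adjF_input, sndF_boolPair]

/-- `AmF` on the input: the capped `adj(−B)`. [folklore] -/
theorem AmF_inp : AmF (inp I t d cs) = matCode (fun l j : Fin I.n => Spec.Ad (Wd I t d cs) I.basis l j) := by
  rw [AmF, Function.comp_apply]
  simp only [fanoutFn_apply, TF_inp]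
  rw [inp, ncW_input, idxnW_input, ← inp, transposeF_apply _ (n_le_Wd I t d cs)
    (n_le_Wd I t d cs), length_ydF_inp]
  rfl

/-- `dD2F` on the input: `bin |D|²`. [folklore] -/
theorem dD2F_inp : dD2F (inp I t d cs) = encodeNat ((Spec.D I.basis).natAbs * (Spec.D I.basis).natAbs) := by
  simp only [dD2F, Function.comp_apply, fanoutFn_apply, dDF_inp, zmagF_apply, ival_dpEnc, prodFn_boolPair, bitsToNat_encodeNat]

/-- `nNF` on the input: `bin (nSamples n)`. [folklore] -/
theorem nNF_inp : nNF (inp I t d cs) = encodeNat (ARVerifier.nSamples I.n) := by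
  have h1 : bitsToNat [true] = 1 := by simp [bitsToNat]
  rw [nNF, Function.comp_apply, fanoutFn_apply]
  simp only [n4F, n2F, n1F, Function.comp_apply, fanoutFn_apply, inp, ncW_input, addFn_boolPair, bitsToNat_encodeNat, h1,
    prodFn_boolPair, ARVerifier.nSamples]
  congr 1; ring

/-- `idxNF` on the input: `idxList N`. [folklore] -/
theorem idxNF_inp : idxNF (inp I t d cs) = idxList (ARVerifier.nSamples I.n) := by
  rw [idxNF, Function.comp_apply, fanoutFn_apply, nNF_inp, iotaF_apply _ (nSamples_le_Wd I t d cs)]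

/-- `pPF` on the input: `bin |bin n|`. [folklore] -/
theorem pPF_inp : pPF (inp I t d cs) = encodeNat (encodeNat I.n).length := by
  rw [pPF, Function.comp_apply, inp, ncW_input, lenBinF_apply]

/-- `pPm1F` on the input: `bin (|bin n| − 1)`. [folklore] -/
theorem pPm1F_inp : pPm1F (inp I t d cs) = encodeNat ((encodeNat I.n).length - 1) := by
  have h1 : bitsToNat [true] = 1 := by simp [bitsToNat]
  rw [pPm1F, Function.comp_apply, fanoutFn_apply, pPF_inp, subFn_boolPair, bitsToNat_encodeNat, h1]

/-- `prmF` on the input. [folklore] -/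
theorem prmF_inp : prmF (inp I t d cs) =
    prmOf (encodeNat I.n) (matCode (fun i k : Fin I.n => I.basis i k)) (rowCode t)
      (matCode (fun l j : Fin I.n => Spec.Ad (Wd I t d cs) I.basis l j)) (dpEnc (Spec.D I.basis))
      (encodeNat ((Spec.D I.basis).natAbs * (Spec.D I.basis).natAbs)) (idxList I.n) := by
  rw [prmF]
  simp only [fanoutFn_apply, AmF_inp, dDF_inp, dD2F_inp, prmOf]
  rw [inp, ncW_input, BnW_input, tnW_input, idxnW_input]

/-! ### The per-sample stages on a well-formed item record -/

section Copy

variable (J : LatticeInstance) (τ : Fin J.n → ℤ) (yd : List Bool) (hn : J.n ≤ yd.length) (c : List Bool)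
  (hc : (canonIV c).length ≤ yd.length)

/-- The item record for the raw code `c` (yardstick `yd`, width `|yd|`). [folklore] -/
abbrev itemRec : List Bool :=
  boolPair yd (boolPair (prmOf (encodeNat J.n) (matCode (fun i k : Fin J.n => J.basis i k)) (rowCode τ)
    (matCode (fun l j : Fin J.n => Spec.Ad yd.length J.basis l j)) (dpEnc (Spec.D J.basis))
    (encodeNat ((Spec.D J.basis).natAbs * (Spec.D J.basis).natAbs)) (idxList J.n)) c)

include hn hc

/-- `cVF` on the item record: `rowCode v`. [folklore] -/
theorem cVF_item : cVF (itemRec J τ yd c) = rowCode (decodeIntVec J.n c) := by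
  obtain ⟨g0, g1, -, -, -, -, -, g7, g8⟩ := getters_apply yd (encodeNat J.n) (matCode (fun i k : Fin J.n => J.basis i k)) (rowCode τ)
    (matCode (fun l j : Fin J.n => Spec.Ad yd.length J.basis l j)) (dpEnc (Spec.D J.basis))
    (encodeNat ((Spec.D J.basis).natAbs * (Spec.D J.basis).natAbs)) (idxList J.n) c
  rw [cVF, Function.comp_apply, fanoutFn_apply, fanoutFn_apply, fanoutFn_apply, itemRec, g0, g1, g7, g8]
  exact vecReadF_apply yd hn c hc

/-- `cUF` on the item record: `rowCode u`. [folklore] -/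
theorem cUF_item : cUF (itemRec J τ yd c) = rowCode (Spec.u yd.length J.basis (decodeIntVec J.n c)) := by
  obtain ⟨g0, g1, g2, -, -, -, -, -, -⟩ := getters_apply yd (encodeNat J.n) (matCode (fun i k : Fin J.n => J.basis i k)) (rowCode τ)
    (matCode (fun l j : Fin J.n => Spec.Ad yd.length J.basis l j)) (dpEnc (Spec.D J.basis))
    (encodeNat ((Spec.D J.basis).natAbs * (Spec.D J.basis).natAbs)) (idxList J.n) c
  have hv := cVF_item J τ yd hn c hc
  rw [itemRec] at hv
  rw [cUF, Function.comp_apply, fanoutFn_apply, fanoutFn_apply, fanoutFn_apply, fanoutFn_apply, itemRec, hv, g0, g1, g2,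
    gVecF_apply yd hn]
  rfl

/-- `cAF` on the item record: `rowCode a`. [folklore] -/
theorem cAF_item : cAF (itemRec J τ yd c) = rowCode (Spec.a yd.length J.basis (decodeIntVec J.n c)) := by
  obtain ⟨g0, g1, -, -, -, g5, -, g7, -⟩ := getters_apply yd (encodeNat J.n) (matCode (fun i k : Fin J.n => J.basis i k)) (rowCode τ)
    (matCode (fun l j : Fin J.n => Spec.Ad yd.length J.basis l j)) (dpEnc (Spec.D J.basis))
    (encodeNat ((Spec.D J.basis).natAbs * (Spec.D J.basis).natAbs)) (idxList J.n) c
  have hu := cUF_item J τ yd hn c hc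
  rw [itemRec] at hu
  rw [cAF, Function.comp_apply, fanoutFn_apply, fanoutFn_apply, fanoutFn_apply, fanoutFn_apply, itemRec, hu, g0, g1, g5, g7,
    divRowF_apply yd hn]
  rfl

/-- `cHF` on the item record: `rowCode h`. [folklore] -/
theorem cHF_item : cHF (itemRec J τ yd c) = rowCode (Spec.h yd.length J.basis (decodeIntVec J.n c)) := by
  obtain ⟨g0, g1, -, -, g4, -, -, -, -⟩ := getters_apply yd (encodeNat J.n) (matCode (fun i k : Fin J.n => J.basis i k)) (rowCode τ)
    (matCode (fun l j : Fin J.n => Spec.Ad yd.length J.basis l j)) (dpEnc (Spec.D J.basis))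
    (encodeNat ((Spec.D J.basis).natAbs * (Spec.D J.basis).natAbs)) (idxList J.n) c
  have ha := cAF_item J τ yd hn c hc
  rw [itemRec] at ha
  rw [cHF, Function.comp_apply, fanoutFn_apply, fanoutFn_apply, fanoutFn_apply, fanoutFn_apply, itemRec, ha, g0, g1, g4,
    gVecF_apply yd hn]
  rfl

/-- `cEF` on the item record: `dpEnc e'`. [folklore] -/
theorem cEF_item : cEF (itemRec J τ yd c) = dpEnc (Spec.e yd.length J.basis τ (decodeIntVec J.n c)) := by
  obtain ⟨g0, g1, -, g3, -, -, -, -, -⟩ := getters_apply yd (encodeNat J.n) (matCode (fun i k : Fin J.n => J.basis i k)) (rowCode τ)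
    (matCode (fun l j : Fin J.n => Spec.Ad yd.length J.basis l j)) (dpEnc (Spec.D J.basis))
    (encodeNat ((Spec.D J.basis).natAbs * (Spec.D J.basis).natAbs)) (idxList J.n) c
  have hh := cHF_item J τ yd hn c hc
  rw [itemRec] at hh
  rw [cEF, Function.comp_apply, fanoutFn_apply, fanoutFn_apply, fanoutFn_apply, itemRec, hh, g0, g1, g3, dotF_apply yd hn]
  rfl

/-- `cMF` on the item record (`D ≠ 0`): `dpEnc m`. [folklore] -/
theorem cMF_item (hD : Spec.D J.basis ≠ 0) : cMF (itemRec J τ yd c) = dpEnc (Spec.m yd.length J.basis τ (decodeIntVec J.n c)) := by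
  obtain ⟨-, -, -, -, -, g5, g6, -, -⟩ := getters_apply yd (encodeNat J.n) (matCode (fun i k : Fin J.n => J.basis i k)) (rowCode τ)
    (matCode (fun l j : Fin J.n => Spec.Ad yd.length J.basis l j)) (dpEnc (Spec.D J.basis))
    (encodeNat ((Spec.D J.basis).natAbs * (Spec.D J.basis).natAbs)) (idxList J.n) c
  have he := cEF_item J τ yd hn c hc
  rw [itemRec] at he
  have hpos : 0 < (Spec.D J.basis).natAbs * (Spec.D J.basis).natAbs := Nat.mul_pos (Int.natAbs_pos.2 hD) (Int.natAbs_pos.2 hD)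
  rw [cMF, Function.comp_apply, fanoutFn_apply, Function.comp_apply, fanoutFn_apply, Function.comp_apply, itemRec, he, g5, g6,
    znegF_eq, ival_dpEnc, zmulF_boolPair, ival_dpEnc, ival_dpEnc, qroundF_dpEnc _ hpos]
  rfl

/-- `cRF` on the item record (`D ≠ 0`): `dpEnc ε`. [folklore] -/
theorem cRF_item (hD : Spec.D J.basis ≠ 0) : cRF (itemRec J τ yd c) = dpEnc (Spec.r yd.length J.basis τ (decodeIntVec J.n c)) := by
  obtain ⟨g0, -, -, -, -, g5, -, -, -⟩ := getters_apply yd (encodeNat J.n) (matCode (fun i k : Fin J.n => J.basis i k)) (rowCode τ)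
    (matCode (fun l j : Fin J.n => Spec.Ad yd.length J.basis l j)) (dpEnc (Spec.D J.basis))
    (encodeNat ((Spec.D J.basis).natAbs * (Spec.D J.basis).natAbs)) (idxList J.n) c
  have he := cEF_item J τ yd hn c hc
  have hm := cMF_item J τ yd hn c hc hD
  rw [itemRec] at he hm
  rw [cRF, Function.comp_apply, fanoutFn_apply, Function.comp_apply, fanoutFn_apply, Function.comp_apply, Function.comp_apply,
    fanoutFn_apply, itemRec, he, hm, g0, g5, znegF_eq, ival_dpEnc, zmulF_boolPair, ival_dpEnc, ival_dpEnc, zsubF_boolPair,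
    ival_dpEnc, ival_dpEnc, zcapF_dpEnc_capZ]
  rfl

/-- **`copyItem` on the item record** (`D ≠ 0`): `⟨rowCode h, dpEnc ε⟩`. [cite: Regev2009, Lemma 3.20 (proof)] -/
theorem copyItem_item (hD : Spec.D J.basis ≠ 0) :
    copyItem (itemRec J τ yd c) =
      boolPair (rowCode (Spec.h yd.length J.basis (decodeIntVec J.n c))) (dpEnc (Spec.r yd.length J.basis τ (decodeIntVec J.n c))) := by
  rw [copyItem, fanoutFn_apply, cHF_item J τ yd hn c hc, cRF_item J τ yd hn c hc hD]

end Copy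

/-! ### The list stages -/

/-- A map over a list, indexed by `Fin N` through `getD`. [folklore] -/
theorem map_eq_ofFn_getD {α β : Type*} (l : List α) (f : α → β) (dflt : α) {N : ℕ} (h : l.length = N) :
    l.map f = List.ofFn (fun j : Fin N => f (l.getD j dflt)) := by
  subst h
  rw [← List.ofFn_getElem_eq_map]
  refine congrArg List.ofFn (funext fun j => ?_)
  rw [List.getD_eq_getElem _ _ j.isLt]

variable (hcs : cs.length = ARVerifier.nSamples I.n) (hcv : ∀ c ∈ cs, (canonIV c).length ≤ Wd I t d cs)
  (hD : Spec.D I.basis ≠ 0)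

include hcs hcv hD

/-- **`recsF` on the input**: the list of the `N` records `⟨hⱼ, εⱼ⟩`. [cite: Regev2009, Lemma 3.20 (proof)] -/
theorem recsF_inp : recsF (inp I t d cs) = encList (List.ofFn fun j : Fin (ARVerifier.nSamples I.n) =>
    boolPair (rowCode (Spec.h (Wd I t d cs) I.basis (vOf I cs _ j))) (dpEnc (Spec.r (Wd I t d cs) I.basis t (vOf I cs _ j)))) := by
  rw [recsF, Function.comp_apply]
  simp only [fanoutFn_apply, nNF_inp, prmF_inp]
  rw [show sndF (inp I t d cs) = encList cs by rw [inp, sndF_boolPair],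
    mapLF_apply _ _ _ (nSamples_le_Wd I t d cs), List.take_of_length_le hcs.le,
    map_eq_ofFn_getD cs _ [] hcs]
  refine congrArg encList (congrArg List.ofFn (funext fun j => ?_))
  have hmem : cs.getD j [] ∈ cs := by
    rw [List.getD_eq_getElem _ _ (by rw [hcs]; exact j.isLt)]; exact List.getElem_mem _
  show copyItem (itemRec I t (ydF (inp I t d cs)) (cs.getD j [])) = _
  rw [copyItem_item I t _ (n_le_Wd I t d cs) _ (hcv _ hmem) hD]
  rfl

/-- `HmF` on the input: `matCode (j ↦ hⱼ)`. [folklore] -/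
theorem HmF_inp : HmF (inp I t d cs) = matCode (fun j : Fin (ARVerifier.nSamples I.n) => Spec.h (Wd I t d cs) I.basis (vOf I cs _ j)) := by
  rw [HmF, Function.comp_apply]
  simp only [fanoutFn_apply, nNF_inp, recsF_inp I t d cs hcs hcv hD]
  rw [mapLF_apply _ _ _ (nSamples_le_Wd I t d cs), List.take_of_length_le (by simp),
    List.map_ofFn, matCode]
  refine congrArg encList (congrArg List.ofFn (funext fun j => ?_))
  simp [hItem]

/-- `epsF` on the input: `rowCode (j ↦ εⱼ)`. [folklore] -/
theorem epsF_inp : epsF (inp I t d cs) = rowCode (fun j : Fin (ARVerifier.nSamples I.n) => Spec.r (Wd I t d cs) I.basis t (vOf I cs _ j)) := by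
  rw [epsF, Function.comp_apply]
  simp only [fanoutFn_apply, nNF_inp, recsF_inp I t d cs hcs hcv hD]
  rw [mapLF_apply _ _ _ (nSamples_le_Wd I t d cs), List.take_of_length_le (by simp),
    List.map_ofFn, rowCode_eq_ofFn]
  refine congrArg encList (congrArg List.ofFn (funext fun j => ?_))
  simp [eItem]

/-- `SF` on the input: `dpEnc S`. [cite: AharonovRegev2005, §6 test (a) — variant] -/
theorem SF_inp : SF (inp I t d cs) = dpEnc (Spec.S (Wd I t d cs) I.basis t (vOf I cs (ARVerifier.nSamples I.n))) := by
  rw [SF, Function.comp_apply]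
  simp only [fanoutFn_apply, nNF_inp, epsF_inp I t d cs hcs hcv hD]
  rw [dotF_apply _ (nSamples_le_Wd I t d cs)]
  rfl

/-- `UF` on the input: `matCode U`. [cite: AharonovRegev2005, §6 (the witness matrix W)] -/
theorem UF_inp : UF (inp I t d cs) = matCode (fun (i : Fin I.n) (j : Fin (ARVerifier.nSamples I.n)) =>
    Spec.U (Wd I t d cs) I.basis (vOf I cs _) i j) := by
  rw [UF, Function.comp_apply]
  simp only [fanoutFn_apply, nNF_inp, HmF_inp I t d cs hcs hcv hD, idxNF_inp]
  rw [inp, ncW_input, idxnW_input, ← inp, transposeF_apply _ (nSamples_le_Wd I t d cs)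
    (n_le_Wd I t d cs), length_ydF_inp]
  rfl

/-- `MF` on the input: `matCode M`. [cite: AharonovRegev2005, §6 test (c) (the matrix W Wᵀ)] -/
theorem MF_inp : MF (inp I t d cs) = matCode (fun i k : Fin I.n => Spec.M (Wd I t d cs) I.basis (vOf I cs (ARVerifier.nSamples I.n)) i k) := by
  rw [MF, Function.comp_apply]
  simp only [fanoutFn_apply, nNF_inp, UF_inp I t d cs hcs hcv hD]
  rw [inp, ncW_input, ← inp, gramRF_apply _ (nSamples_le_Wd I t d cs)
    (n_le_Wd I t d cs), length_ydF_inp]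
  rfl

/-- `MpF` on the input: `matCode M'`. [cite: AharonovRegev2005, §6 test (c) — variant (trace of a power)] -/
theorem MpF_inp : MpF (inp I t d cs) = matCode (fun i k : Fin I.n => Spec.Mp (Wd I t d cs) I.basis (vOf I cs (ARVerifier.nSamples I.n)) i k) := by
  rw [MpF, Function.comp_apply, Function.comp_apply]
  simp only [fanoutFn_apply, pPm1F_inp, MF_inp I t d cs hcs hcv hD]
  rw [inp, ncW_input, idxnW_input, ← inp,
    sqLoopF_apply _ (n_le_Wd I t d cs)
      ((Nat.sub_le _ _).trans (length_encodeNat_n_le_Wd I t d cs))]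
  simp only [sndPow_succ_boolPair, sndPow_zero, sndF_boolPair, length_ydF_inp]
  rfl

/-- `trF` on the input: `dpEnc tr`. [cite: AharonovRegev2005, §6 test (c) — variant (trace of a power)] -/
theorem trF_inp : trF (inp I t d cs) = dpEnc (Spec.tr (Wd I t d cs) I.basis (vOf I cs (ARVerifier.nSamples I.n))) := by
  rw [trF, Function.comp_apply]
  simp only [fanoutFn_apply, MpF_inp I t d cs hcs hcv hD]
  rw [inp, ncW_input, ← inp, AdjMachine.traceF_apply _ (n_le_Wd I t d cs), length_ydF_inp]
  rfl

omit hcs hcv hD in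
/-- `alphaPF` on the input: `dpEnc αP`. [folklore] -/
theorem alphaPF_inp : alphaPF (inp I t d cs) = dpEnc (Spec.alphaP (n := I.n) (Wd I t d cs) d) := by
  rw [alphaPF, Function.comp_apply, Function.comp_apply]
  simp only [fanoutFn_apply, pPF_inp, alphaF, a1F, Function.comp_apply, natZF_apply, prodFn_boolPair, bitsToNat_encodeNat]
  rw [inp, numW_input, ← inp, bitsToNat_encodeNat, powLoopF_apply _ (length_encodeNat_n_le_Wd I t d cs)]
  simp only [sndPow_succ_boolPair, sndPow_zero, sndF_boolPair, length_ydF_inp]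
  rfl

omit hcs hcv hD in
/-- `betaPF` on the input: `dpEnc βP`. [folklore] -/
theorem betaPF_inp : betaPF (inp I t d cs) = dpEnc (Spec.betaP (N := ARVerifier.nSamples I.n) (Wd I t d cs) I.basis d) := by
  rw [betaPF, Function.comp_apply, Function.comp_apply]
  simp only [fanoutFn_apply, pPF_inp, betaF, denDF, Function.comp_apply, natZF_apply, prodFn_boolPair, bitsToNat_encodeNat,
    nNF_inp, dDF_inp, zmulF_boolPair, ival_dpEnc]
  rw [inp, denW_input, ← inp, bitsToNat_encodeNat, powLoopF_apply _ (length_encodeNat_n_le_Wd I t d cs)]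
  simp only [sndPow_succ_boolPair, sndPow_zero, sndF_boolPair, length_ydF_inp]
  rfl

/-- **The verdict on the input** (`D ≠ 0`): the Boolean `Spec.verdict` of the saturated arithmetic.
[cite: Regev2009, Lemma 3.20 (proof, p. 22)] -/
theorem verdictF_inp : verdictF (inp I t d cs) = [Spec.verdict (Wd I t d cs) I.basis t d (vOf I cs (ARVerifier.nSamples I.n))] := by
  have h1 : test1F (inp I t d cs) = [decide (Spec.D I.basis ≠ 0)] := by
    rw [test1F, notFn_apply (b := decide (Spec.D I.basis = 0))]
    · simp
    · rw [Function.comp_apply, dDF_inp, isZeroFn_apply, ival_dpEnc]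
  have h2 : test2F (inp I t d cs) = [decide (((ARVerifier.nSamples I.n : ℕ) : ℤ) * (Spec.D I.basis * Spec.D I.basis) ≤
      50 * Spec.S (Wd I t d cs) I.basis t (vOf I cs (ARVerifier.nSamples I.n)))] := by
    simp only [test2F, Function.comp_apply, fanoutFn_apply, nNF_inp, natZF_apply, bitsToNat_encodeNat, dDF_inp, zmulF_boolPair,
      ival_dpEnc, SF_inp I t d cs hcs hcv hD, zleF_boolPair]
  have h3 : test3F (inp I t d cs) = [decide (Spec.alphaP (n := I.n) (Wd I t d cs) d * Spec.tr (Wd I t d cs) I.basis (vOf I cs (ARVerifier.nSamples I.n)) ≤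
      Spec.betaP (N := ARVerifier.nSamples I.n) (Wd I t d cs) I.basis d)] := by
    simp only [test3F, Function.comp_apply, fanoutFn_apply, alphaPF_inp, trF_inp I t d cs hcs hcv hD, betaPF_inp, zmulF_boolPair,
      ival_dpEnc, zleF_boolPair]
  rw [verdictF, notFn_apply (andFn_apply h1 (andFn_apply h2 h3)), Spec.verdict]

omit hcs hcv hD in
/-- **The verdict on a singular instance** (`D = 0`): `[true]` (test 1 fails; the conjunction short-circuits),
which is `Spec.verdict` as well. [folklore] -/
theorem verdictF_inp_of_D_eq_zero (h0 : Spec.D I.basis = 0) :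
    verdictF (inp I t d cs) = [Spec.verdict (Wd I t d cs) I.basis t d (vOf I cs (ARVerifier.nSamples I.n))] := by
  have h1 : test1F (inp I t d cs) = [false] := by
    rw [test1F, notFn_apply (b := true)]
    · rfl
    · rw [Function.comp_apply, dDF_inp, isZeroFn_apply, ival_dpEnc, h0]; rfl
  have hand : andFn test1F (andFn test2F test3F) (inp I t d cs) = [false] := by
    rw [andFn, iteFn_apply_false h1]
  rw [verdictF, notFn_apply hand, Spec.verdict]
  simp [h0]

omit hcs hcv hD in
/-- **The value of the verdict machine** on `⟨codeOf I t d, encList cs⟩` for `N` raw codes whose canonical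
re-encodings fit the yardstick: the Boolean `Spec.verdict` of the saturated arithmetic of Part B.
[cite: Regev2009, Lemma 3.20 (proof, p. 22)] -/
theorem verdictF_eq_spec (hcs : cs.length = ARVerifier.nSamples I.n) (hcv : ∀ c ∈ cs, (canonIV c).length ≤ Wd I t d cs) :
    verdictF (inp I t d cs) = [Spec.verdict (Wd I t d cs) I.basis t d (vOf I cs (ARVerifier.nSamples I.n))] := by
  by_cases hD : Spec.D I.basis = 0
  · exact verdictF_inp_of_D_eq_zero I t d cs hD
  · exact verdictF_inp I t d cs hcs hcv hD

end Value

end ARMachine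

end Literature.Algebra.EuclideanLattices

end
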